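import Literature.AlgebraicGeometry.Frobenioids.DivisorialDescriptionsSectionsClosed
import Literature.AlgebraicGeometry.Frobenioids.UnitTrivializationIsFrobenioid
import HarnessLib

/-!
# Frobenioids I, Theorem 5.1 (iv): skeletal subcategories of `(C^Fr-tr)^pl-bk` EXIST
# (abc-iut cell, layer L1, §4(iii) non-vacuity; NV-L1 row `PreFrobenioid.IsSkeletalSubcatFrTrPlbk`)

Mochizuki, *The geometry of Frobenioids I: the general theory*, Kyushu J. Math. **62** (2008)
293–400, §5, Theorem 5.1 (iv), kurims text p. 97 ll. 18–20 (statement) and p. 99 l. 47 – p. 100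
l. 1 (proof) [cite: MochizukiFrdI2008, Thm. 5.1 (iv) p.97]; "skeletal subcategory" = §0 p. 15.

PROOF-ONLY file (no `def`, no `structure`, no `instance`). The hypothesis of the first clause of
Theorem 5.1 (iv) — "any skeletal subcategory `P ⊆ (C^Fr-tr)^pl-bk` determines a base-section of `C`",
typed as `PreFrobenioid.Thm51iv_baseSection` (`DivisorialDescriptionsSections.lean`, seat
abc-iut-L1-t5) and PROVED unconditionally as `PreFrobenioid.thm51iv_baseSection`
(`DivisorialDescriptionsSectionsClosed.lean`, seat abc-iut-L1-d3) — is the Prop-structure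
`PreFrobenioid.IsSkeletalSubcatFrTrPlbk F P`. The kernel inhabitation census CENSUS-CELL-v3
(abc-iut-w5-d056, 2026-08-26) lists it with 4 consumers and 0 producers: until now a term of it was
built only INSIDE the proof of `PreFrobenioid.thm51iv_preModel_of_thm51iii`
(`DivisorialDescriptionsSectionsProofs.lean` ll. 270–305, seat abc-iut-L1-d3), so the proved clause
was formally consistent with having no instance to apply to. Here, for EVERY pre-Frobenioid
`F : C → F_Φ` (no hypothesis on `C`, `Φ` or `D`):

* `exists_isSkeletalSubcatFrTrPlbk_obj` — through ANY prescribed Frobenius-trivial object `A₀` there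
  is a skeletal subcategory `P ⊆ (C^Fr-tr)^pl-bk` with `A₀ ∈ Ob(P)` (representatives of the
  isomorphism classes of Frobenius-trivial objects, the class of `A₀` represented by `A₀` itself, with
  the pull-back morphisms of `C` between them — the construction of the printed proof, p. 99, and of
  abc-iut-L1-d3's proof term, made a named producer);
* `exists_isSkeletalSubcatFrTrPlbk` — a skeletal subcategory `P ⊆ (C^Fr-tr)^pl-bk` exists (the empty
  one if `C` has no Frobenius-trivial object);
* consequences for a Frobenioid of isotropic and unit-trivial type (the hypotheses of Thm. 5.1 (iv)),
  by the landed closers BY NAME: a base-section of `C` that is skeletal in `(C^Fr-tr)^pl-bk` EXISTS and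
  may be taken through any Frobenius-trivial object (`exists_skeletal_isBaseSection`,
  `exists_skeletal_isBaseSection_obj`), and so may a base-Frobenius pair
  (`exists_isBaseFrobeniusPair_obj`; Def. 2.7 (iii) p. 52) — the form in which §5 uses base-sections
  "of objects" (cf. Prop. 5.6, Cor. 5.7 p. 107);
* GENUINE instances AT THE CONSTRUCTION `C^un-tr` (the unit-trivialization, Prop. 3.3 (iv) p. 60,
  `PreFrobenioid.untrFunctor`, seat abc-iut-L1-t3 lineage) of EVERY Frobenioid `C`: `C^un-tr` is a
  Frobenioid (`isFrobenioid_untr`) of isotropic (`isOfIsotropicType_untr`) and unit-trivial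
  (`isOfUnitTrivialType_untr`) type — the three landed closers BY NAME — hence has a base-section
  skeletal in `((C^un-tr)^Fr-tr)^pl-bk` and a base-Frobenius pair through any Frobenius-trivial object
  (`exists_skeletal_isBaseSection_untr`, `exists_isBaseFrobeniusPair_untr`): the step "`C^un-tr` is of
  model type" of the proof of Thm. 5.1 (p. 100 ll. 1–5) with no hypothesis beyond "`C` is a Frobenioid".

Honest framing: classical, undisputed mathematics ([FrdI] is a refereed prerequisite); nothing here
bears on [IUTchIII] Cor. 3.12 or asserts anything about abc; a zero row of the census is «not yet
witnessed», never «vacuous»; typed ≠ proved.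
-/

namespace Literature.AlgebraicGeometry.Frobenioids

namespace PreFrobenioid

open CategoryTheory

universe w v v' u u'

variable {D : Type u} [Category.{v} D] {Φ : Dᵒᵖ ⥤ CommMonCat.{w}}
  {C : Type u'} [Category.{v'} C] (F : C ⥤ ElemFrobenioid Φ)

/-! ### The skeleton on a system of representatives -/

/-- A system of representatives `rep` of the isomorphism classes of Frobenius-trivial objects
(Frobenius-trivial, isomorphic to the represented object, constant on isomorphism classes) spans,
together with the pull-back morphisms of `C` between representatives, a skeletal subcategory
`P ⊆ (C^Fr-tr)^pl-bk` whose objects are exactly the representatives (the construction of the proof of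
Thm. 5.1 (iv), p. 99; proof term adapted from abc-iut-L1-d3's `thm51iv_preModel_of_thm51iii`).
[cite: MochizukiFrdI2008, Thm. 5.1 (iv) p.97] -/
theorem exists_isSkeletalSubcatFrTrPlbk_of_rep (rep : {A : C // IsFrobeniusTrivial F A} → C)
    (rep_ft : ∀ A, IsFrobeniusTrivial F (rep A)) (rep_iso : ∀ A, Nonempty (rep A ≅ A.1))
    (rep_eq : ∀ A B, Nonempty (A.1 ≅ B.1) → rep A = rep B) :
    ∃ P : Presection C, IsSkeletalSubcatFrTrPlbk F P ∧
      ∀ A : C, P.obj A ↔ ∃ h : IsFrobeniusTrivial F A, rep ⟨A, h⟩ = A := by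
  let Pobj : C → Prop := fun A => ∃ h : IsFrobeniusTrivial F A, rep ⟨A, h⟩ = A
  let P : Presection C :=
    { obj := Pobj
      hom := fun {A B} f => Pobj A ∧ Pobj B ∧ IsPullbackMorphism F f
      obj_of_hom := fun f hf => ⟨hf.1, hf.2.1⟩
      hom_id := fun {A} hA => ⟨hA, hA, isPullbackMorphism_of_isIso F (𝟙 A)⟩
      hom_comp := fun f g hf hg => ⟨hf.1, hg.2.1, IsPullbackMorphism.comp F hf.2.2 hg.2.2⟩ }
  refine ⟨P, ?_, fun A => Iff.rfl⟩
  exact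
    { obj_isFrobeniusTrivial := fun A hA => hA.1
      hom_iff := fun f => Iff.rfl
      isSkeleton := fun A B hAB => by
        obtain ⟨e⟩ := hAB
        obtain ⟨hA, hA'⟩ := A.2
        obtain ⟨hB, hB'⟩ := B.2
        apply Subtype.ext
        have e' : A.1 ≅ B.1 := P.ι.mapIso e
        calc A.1 = rep ⟨A.1, hA⟩ := hA'.symm
          _ = rep ⟨B.1, hB⟩ := rep_eq _ _ ⟨e'⟩
          _ = B.1 := hB'
      essSurj := fun A hA => by
        obtain ⟨e⟩ := rep_iso ⟨A, hA⟩
        exact ⟨rep ⟨A, hA⟩, ⟨rep_ft ⟨A, hA⟩, rep_eq _ _ ⟨e⟩⟩, ⟨e.symm⟩⟩ }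

/-! ### Existence -/

/-- **Producer (generic).** Through any Frobenius-trivial object `A₀` of a pre-Frobenioid `C` there is
a skeletal subcategory `P ⊆ (C^Fr-tr)^pl-bk` (Thm. 5.1 (iv) p. 97; §0 p. 15) with `A₀ ∈ Ob(P)`:
represent the isomorphism class of `A₀` by `A₀` and every other class of Frobenius-trivial objects by a
chosen member. [cite: MochizukiFrdI2008, Thm. 5.1 (iv) p.97] -/
theorem exists_isSkeletalSubcatFrTrPlbk_obj {A₀ : C} (hA₀ : IsFrobeniusTrivial F A₀) :
    ∃ P : Presection C, IsSkeletalSubcatFrTrPlbk F P ∧ P.obj A₀ := by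
  classical
  let S : Setoid {A : C // IsFrobeniusTrivial F A} :=
    ⟨fun A B => Nonempty (A.1 ≅ B.1),
      ⟨fun A => ⟨Iso.refl A.1⟩, fun ⟨e⟩ => ⟨e.symm⟩, fun ⟨e₁⟩ ⟨e₂⟩ => ⟨e₁ ≪≫ e₂⟩⟩⟩
  let rep : {A : C // IsFrobeniusTrivial F A} → C := fun A =>
    if Nonempty (A.1 ≅ A₀) then A₀ else (Quotient.mk S A).out.1
  have rep_pos : ∀ A, Nonempty (A.1 ≅ A₀) → rep A = A₀ := fun A h => if_pos h
  have rep_neg : ∀ A, ¬ Nonempty (A.1 ≅ A₀) → rep A = (Quotient.mk S A).out.1 :=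
    fun A h => if_neg h
  have rep_ft : ∀ A, IsFrobeniusTrivial F (rep A) := fun A => by
    by_cases h : Nonempty (A.1 ≅ A₀)
    · rw [rep_pos A h]; exact hA₀
    · rw [rep_neg A h]; exact (Quotient.mk S A).out.2
  have rep_iso : ∀ A, Nonempty (rep A ≅ A.1) := fun A => by
    by_cases h : Nonempty (A.1 ≅ A₀)
    · rw [rep_pos A h]; exact ⟨(Classical.choice h).symm⟩
    · rw [rep_neg A h]; exact Quotient.mk_out (s := S) A
  have rep_eq : ∀ A B, Nonempty (A.1 ≅ B.1) → rep A = rep B := fun A B hAB => by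
    obtain ⟨e⟩ := hAB
    by_cases h : Nonempty (A.1 ≅ A₀)
    · have hB : Nonempty (B.1 ≅ A₀) := ⟨e.symm ≪≫ Classical.choice h⟩
      rw [rep_pos A h, rep_pos B hB]
    · have hB : ¬ Nonempty (B.1 ≅ A₀) := fun ⟨e'⟩ => h ⟨e ≪≫ e'⟩
      rw [rep_neg A h, rep_neg B hB, Quotient.sound (s := S) ⟨e⟩]
  obtain ⟨P, hP, hobj⟩ := exists_isSkeletalSubcatFrTrPlbk_of_rep F rep rep_ft rep_iso rep_eq
  exact ⟨P, hP, (hobj A₀).2 ⟨hA₀, rep_pos ⟨A₀, hA₀⟩ ⟨Iso.refl A₀⟩⟩⟩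

/-- **Producer (generic).** Every pre-Frobenioid `C` has a skeletal subcategory `P ⊆ (C^Fr-tr)^pl-bk`
(Thm. 5.1 (iv) p. 97; §0 p. 15) — the empty subcategory if `C` has no Frobenius-trivial object, else
the one of `exists_isSkeletalSubcatFrTrPlbk_obj`. [cite: MochizukiFrdI2008, Thm. 5.1 (iv) p.97] -/
theorem exists_isSkeletalSubcatFrTrPlbk : ∃ P : Presection C, IsSkeletalSubcatFrTrPlbk F P := by
  by_cases h : ∃ A : C, IsFrobeniusTrivial F A
  · obtain ⟨A, hA⟩ := h
    obtain ⟨P, hP, -⟩ := exists_isSkeletalSubcatFrTrPlbk_obj F hA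
    exact ⟨P, hP⟩
  · -- the empty subcategory
    refine ⟨⟨fun _ => False, fun _ => False, fun _ hf => hf.elim, fun hA => hA.elim,
      fun _ _ hf _ => hf.elim⟩, ?_⟩
    exact ⟨fun A hA => hA.elim, fun f => ⟨fun hf => hf.elim, fun hf => hf.1.elim⟩,
      fun A => A.2.elim, fun A hA => (h ⟨A, hA⟩).elim⟩

/-! ### Theorem 5.1 (iv), first clause and "Moreover": the non-vacuous forms -/

/-- **Theorem 5.1 (iv), first clause, NON-VACUOUS form** (consequence, by the landed closer
`thm51iv_baseSection` BY NAME): a Frobenioid of isotropic and unit-trivial type HAS a base-section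
(Def. 2.7 (i) p. 51) that is a skeletal subcategory of `(C^Fr-tr)^pl-bk`.
[cite: MochizukiFrdI2008, Thm. 5.1 (iv) p.97] -/
theorem exists_skeletal_isBaseSection (hF : IsFrobenioid F) (hiso : IsOfIsotropicType F)
    (hut : IsOfUnitTrivialType F) :
    ∃ P : Presection C, IsSkeletalSubcatFrTrPlbk F P ∧ IsBaseSection F P := by
  obtain ⟨P, hP⟩ := exists_isSkeletalSubcatFrTrPlbk F
  exact ⟨P, hP, thm51iv_baseSection F hF hiso hut P hP⟩

/-- **Theorem 5.1 (iv), first clause, NON-VACUOUS form through an object** (consequence): for a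
Frobenioid of isotropic and unit-trivial type and any Frobenius-trivial object `A₀`, there is a
base-section `P` of `C`, skeletal in `(C^Fr-tr)^pl-bk`, with `A₀ ∈ Ob(P)` (base-sections "of objects",
cf. Prop. 5.6 / Cor. 5.7 p. 107). [cite: MochizukiFrdI2008, Thm. 5.1 (iv) p.97] -/
theorem exists_skeletal_isBaseSection_obj (hF : IsFrobenioid F) (hiso : IsOfIsotropicType F)
    (hut : IsOfUnitTrivialType F) {A₀ : C} (hA₀ : IsFrobeniusTrivial F A₀) :
    ∃ P : Presection C, IsSkeletalSubcatFrTrPlbk F P ∧ IsBaseSection F P ∧ P.obj A₀ := by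
  obtain ⟨P, hP, hA⟩ := exists_isSkeletalSubcatFrTrPlbk_obj F hA₀
  exact ⟨P, hP, thm51iv_baseSection F hF hiso hut P hP, hA⟩

/-- **Theorem 5.1 (iv), "Moreover", NON-VACUOUS form through an object** (consequence, by
`thm51iv_baseSection` and `thm51iv_frobeniusSection` BY NAME): a Frobenioid of isotropic and
unit-trivial type admits a base-Frobenius pair `(P, F)` (Def. 2.7 (iii) p. 52) whose base-section `P`
is skeletal in `(C^Fr-tr)^pl-bk` and passes through any prescribed Frobenius-trivial object `A₀`.
[cite: MochizukiFrdI2008, Thm. 5.1 (iv) p.97] -/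
theorem exists_isBaseFrobeniusPair_obj (hF : IsFrobenioid F) (hiso : IsOfIsotropicType F)
    (hut : IsOfUnitTrivialType F) {A₀ : C} (hA₀ : IsFrobeniusTrivial F A₀) :
    ∃ (P : Presection C) (Fr : ℕ+ →* End P.ι),
      IsSkeletalSubcatFrTrPlbk F P ∧ IsBaseFrobeniusPair F P Fr ∧ P.obj A₀ := by
  obtain ⟨P, hP, hbs, hA⟩ := exists_skeletal_isBaseSection_obj F hF hiso hut hA₀
  obtain ⟨Fr, hFr⟩ := thm51iv_frobeniusSection F hF hiso hut P hbs
  exact ⟨P, Fr, hP, ⟨hbs, hFr⟩, hA⟩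

/-! ### Genuine instances: the unit-trivialization `C^un-tr` of any Frobenioid -/

section Untr

open PreFrobenioidData (ofFunctor)

/-- **GENUINE instance at `C^un-tr`.** For EVERY Frobenioid `C`, the unit-trivialization `C^un-tr → F_Φ`
(Prop. 3.3 (iv) p. 60) — a Frobenioid of isotropic and unit-trivial type by the landed closers
`isFrobenioid_untr`, `isOfIsotropicType_untr`, `isOfUnitTrivialType_untr` — has a base-section
(Def. 2.7 (i)) that is a skeletal subcategory of `((C^un-tr)^Fr-tr)^pl-bk` (Thm. 5.1 (iv) p. 97 applied
to `C^un-tr`, as in the proof of Thm. 5.1, p. 100). [cite: MochizukiFrdI2008, Thm. 5.1 (iv) p.97] -/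
theorem exists_skeletal_isBaseSection_untr (hF : IsFrobenioid F) :
    ∃ P : Presection (ofFunctor Φ F).Untr,
      IsSkeletalSubcatFrTrPlbk (untrFunctor hF) P ∧ IsBaseSection (untrFunctor hF) P :=
  exists_skeletal_isBaseSection (untrFunctor hF) (isFrobenioid_untr hF) (isOfIsotropicType_untr hF)
    (isOfUnitTrivialType_untr hF)

/-- **GENUINE instance at `C^un-tr`.** For EVERY Frobenioid `C` and every Frobenius-trivial object `X`
of `C^un-tr`, there is a base-Frobenius pair `(P, F)` of `C^un-tr` (Def. 2.7 (iii) p. 52) with `P`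
skeletal in `((C^un-tr)^Fr-tr)^pl-bk` and `X ∈ Ob(P)`; in particular `C^un-tr` is of pre-model type
through `X` (Thm. 5.1 (iv) applied to `C^un-tr`, proof of Thm. 5.1 p. 100 ll. 1–5).
[cite: MochizukiFrdI2008, Thm. 5.1 (iv) p.97] -/
theorem exists_isBaseFrobeniusPair_untr (hF : IsFrobenioid F) {X : (ofFunctor Φ F).Untr}
    (hX : IsFrobeniusTrivial (untrFunctor hF) X) :
    ∃ (P : Presection (ofFunctor Φ F).Untr) (Fr : ℕ+ →* End P.ι),
      IsSkeletalSubcatFrTrPlbk (untrFunctor hF) P ∧ IsBaseFrobeniusPair (untrFunctor hF) P Fr ∧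
        P.obj X :=
  exists_isBaseFrobeniusPair_obj (untrFunctor hF) (isFrobenioid_untr hF) (isOfIsotropicType_untr hF)
    (isOfUnitTrivialType_untr hF) hX

end Untr

end PreFrobenioid

end Literature.AlgebraicGeometry.Frobenioids
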